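import Summits.KontsevichZagierPeriods.KontsevichZagierPeriods.Theorems.SoloInformedFlattening
import Summits.KontsevichZagierPeriods.KontsevichZagierPeriods.Theorems.SoloInformedEquidimStability
import Literature.NumberTheory.Transcendental.KZVolumeConjectureProofs
import Literature.NumberTheory.Transcendental.KZKernelConjectureForms
import Summits.KontsevichZagierPeriods.KontsevichZagierPeriods.Statement
import HarnessLib
import HarnessLib.Audit

/-!
# SoloInformed — the stable scissors group of the KZ calculus and STABLE-H3 (COROLLARY NF.2, file A)

Solo programme `solo-KontsevichZagierPeriods-informed`, session s247 (K-NF.2: the kernel form of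
COROLLARY NF.2 of `paper/nl-elimination.md`, "the period conjecture is a stable generalized Hilbert
third problem"; this is the first of its files).

**The objects.**  A *volume representation* is an integral representation `[σ, f]` of the KZ calculus
with `f = 1` on `σ` (`SoloInformedIsVolRep`): its value is `vol σ` and `σ ⊆ ℝⁿ` is any
`ℚ`-semialgebraic set of finite volume (not necessarily compact, not necessarily top-dimensional).
Between volume representations two kinds of KZ moves make sense on their own:

* *scissors moves* (`soloInformedScissorsGen`): `[σ] − [σ₁] − [σ₂]` with `σ = σ₁ ∪ σ₂`,
  `vol (σ₁ ∩ σ₂) = 0` — KZ's rule (1a) between volume representations;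
* *volume-preserving semialgebraic maps* (`soloInformedMapGen`): `[σ] − [Φ σ]` for a
  `ℚ`-semialgebraic map `Φ`, injective and differentiable within `σ` — KZ's rule (2) between volume
  representations, whose Jacobian clause `1 = 1 · |det Φ'|` says exactly that `Φ` preserves volume
  (`|det Φ'| = 1` on `σ`).

They generate the **scissors group of relations** `𝒮 = soloInformedScissorsRel ≤ relations₁₂`, and
`K(ℚ) := (free abelian group on volume representations) ⧸ 𝒮` is the Grothendieck group of finite-volume
`ℚ`-semialgebraic sets modulo cut-and-paste and volume-preserving `ℚ`-semialgebraic
`C¹`-injections — the "♭" (finite-volume, maps-on-the-set) variant of the group of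
Cresson–Viu-Sos [CVS22, §3] (who use compact top-dimensional sets, `C¹` volume-preserving maps on
open neighbourhoods, and build the flattening `[K × [0,1]] = [K]` into the relations).

**The statements typed here.**
* `SoloInformedH3At n` (**H3ₙ**, the generalized Hilbert third problem of the calculus in dimension
  `n`): two volume representations of dimension `n` with the same volume are congruent modulo `𝒮`.
* `SoloInformedStableH3` (**STABLE-H3**): two volume representations of the same dimension with the
  same volume become congruent modulo `𝒮` after multiplying both by a cube `[0,1]ᵏ`
  (`soloInformedFlatIter`).

**Proved here (all unconditional).**
* `𝒮 ≤ relations₁₂ ≤ relations`, `eval = 0` on `𝒮`; null volume representations vanish in `K(ℚ)`;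
  two volume representations with the same domain agree in `K(ℚ)`; rational translates agree in `K(ℚ)`;
* (in the companion file `SoloInformedScissorsIdeal`) `𝒮` is stable under `[τ] * ·` and `· * [τ]`
  for every volume representation `τ`, in particular under the flattening operator `Fl = · * [[0,1]]`,
  and under the degree projections `π_d`;
* **`soloInformed_summit_of_stableH3 : SoloInformedStableH3 → KontsevichZagierPeriods`** and
  `soloInformed_summit_of_forall_h3At : (∀ n, SoloInformedH3At n) → KontsevichZagierPeriods`
  (through the volume form of Conjecture 1, `KZ.volumeConjectureCompact`, equivalent to the summit by
  Viu-Sos' semi-canonical reduction — both in `Literature`): the easy direction of COROLLARY NF.2,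
  the analogue for `K(ℚ)` of [CVS22, Thm. 2.1] "GKZ ⟹ KZ".

The converse `KontsevichZagierPeriods → SoloInformedStableH3` ("density removal": an
equidimensional chain between volume representations can be pushed, through the regions under the
graphs, into a scissors chain one dimension up) is THEOREM NF's business and is the subject of the
next files; with it STABLE-H3 is EQUIVALENT to the summit (COROLLARY NF.2), whereas for H3ₙ itself
neither implication with the summit restricted to one dimension is claimed.

References: M. Kontsevich, D. Zagier, *Periods* (2001), §1.2 rules (1), (2), Conjecture 1;
J. Cresson, J. Viu-Sos, JTNB 34 (2022) 323–343 [CVS22], §1 p. 326 (volume form), Thm. 2.1, §3, §5;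
J. Viu-Sos, IJNT 17 (2021), Thm. 1.1, Cor. 2.3; this work, `paper/nl-elimination.md` COROLLARY NF.2,
REMARK NF.4–NF.5.
-/

noncomputable section

open scoped BigOperators

namespace Summit.KontsevichZagierPeriods.KontsevichZagierPeriods.Theorems

open Set MeasureTheory
open Literature.ModelTheory.ExponentialFields
open Literature.NumberTheory.Transcendental Literature.NumberTheory.Transcendental.KZ

variable {n m l k d : ℕ}

/-! ### Volume representations -/

/-- A **volume representation**: an integral representation whose integrand is `1` on its domain,
`[σ, 1]`, representing `vol σ`. [Kontsevich–Zagier 2001, §1.1; Cresson–Viu-Sos 2022, §1] -/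
def SoloInformedIsVolRep (r : IntegralRep n) : Prop :=
  ∀ x ∈ r.domain, r.integrand x = 1

/-- The value of a volume representation is the volume of its domain. [folklore] -/
theorem soloInformed_value_of_isVolRep {r : IntegralRep n} (h : SoloInformedIsVolRep r) :
    r.value = volume.real r.domain :=
  IntegralRep.value_eq_volume_real r h

/-- **The volume representation `[σ, 1]` of a `ℚ`-semialgebraic set of finite volume.**
[Kontsevich–Zagier 2001, §1.1] -/
def soloInformedVolRepOf (σ : Set (Fin n → ℝ)) (hσ : IsSemialgebraic ℚ σ) (hfin : volume σ ≠ ⊤) :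
    IntegralRep n where
  domain := σ
  integrand := fun _ => 1
  isSemialgebraic_domain := hσ
  isSemialgebraicFunOn_integrand := by simpa using isSemialgebraicFunOn_ratCast hσ 1
  integrableOn := integrableOn_const hfin

/-- The domain of `[σ, 1]` is `σ`. -/
@[simp] theorem soloInformed_volRepOf_domain (σ : Set (Fin n → ℝ)) (hσ : IsSemialgebraic ℚ σ)
    (hfin : volume σ ≠ ⊤) : (soloInformedVolRepOf σ hσ hfin).domain = σ := rfl

/-- The integrand of `[σ, 1]` is `1`. -/
@[simp] theorem soloInformed_volRepOf_integrand (σ : Set (Fin n → ℝ)) (hσ : IsSemialgebraic ℚ σ)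
    (hfin : volume σ ≠ ⊤) (x : Fin n → ℝ) : (soloInformedVolRepOf σ hσ hfin).integrand x = 1 := rfl

/-- `[σ, 1]` is a volume representation. -/
theorem soloInformed_isVolRep_volRepOf (σ : Set (Fin n → ℝ)) (hσ : IsSemialgebraic ℚ σ)
    (hfin : volume σ ≠ ⊤) : SoloInformedIsVolRep (soloInformedVolRepOf σ hσ hfin) :=
  fun _ _ => rfl

/-- `value [σ, 1] = vol σ`. [folklore] -/
theorem soloInformed_value_volRepOf (σ : Set (Fin n → ℝ)) (hσ : IsSemialgebraic ℚ σ)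
    (hfin : volume σ ≠ ⊤) : (soloInformedVolRepOf σ hσ hfin).value = volume.real σ :=
  soloInformed_value_of_isVolRep (soloInformed_isVolRep_volRepOf σ hσ hfin)

/-- The unit interval `[[0,1], 1]` is a volume representation. -/
theorem soloInformed_isVolRep_unitIntervalRep : SoloInformedIsVolRep soloInformedUnitIntervalRep :=
  fun _ _ => rfl

/-- Products of volume representations are volume representations (`1 ⊗ 1 = 1`). [folklore] -/
theorem soloInformed_isVolRep_prod {r : IntegralRep n} {s : IntegralRep m}
    (hr : SoloInformedIsVolRep r) (hs : SoloInformedIsVolRep s) : SoloInformedIsVolRep (r.prod s) := by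
  intro z hz
  rw [IntegralRep.prod_domain, IntegralRep.mem_prodDomain] at hz
  rw [IntegralRep.prod_integrand_eq, IntegralRep.prodFun_apply, hr _ hz.1, hs _ hz.2, mul_one]

/-- The flattening `r × [0,1]` of a volume representation is a volume representation. -/
theorem soloInformed_isVolRep_flat {r : IntegralRep n} (hr : SoloInformedIsVolRep r) :
    SoloInformedIsVolRep (soloInformedFlat r) :=
  soloInformed_isVolRep_prod hr soloInformed_isVolRep_unitIntervalRep

/-- The iterated flattening `r × [0,1]ᵏ` of a volume representation is a volume representation. -/
theorem soloInformed_isVolRep_flatIter {r : IntegralRep n} (hr : SoloInformedIsVolRep r) (k : ℕ) :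
    SoloInformedIsVolRep (soloInformedFlatIter r k) := by
  induction k with
  | zero => exact hr
  | succ k ih => exact soloInformed_isVolRep_flat ih

/-- A coordinate reindexing of a volume representation is a volume representation. -/
theorem soloInformed_isVolRep_reindex {r : IntegralRep n} (hr : SoloInformedIsVolRep r)
    (e : Fin n ≃ Fin k) : SoloInformedIsVolRep (r.reindex e) :=
  fun _ hw => hr _ hw

/-! ### The generators: scissors moves and volume-preserving maps -/

/-- **Scissors moves** between volume representations: the instances `[σ] − [σ₁] − [σ₂]` of KZ's
rule (1a) (`σ = σ₁ ∪ σ₂`, `vol (σ₁ ∩ σ₂) = 0`) all three of whose terms are volume representations.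
[Kontsevich–Zagier 2001, §1.2 rule (1); Cresson–Viu-Sos 2022, §3 (scissors relations)] -/
def soloInformedScissorsGen : Set FormalRep :=
  {c | ∃ (n : ℕ) (r r₁ r₂ : IntegralRep n), SoloInformedIsVolRep r ∧ SoloInformedIsVolRep r₁ ∧
    SoloInformedIsVolRep r₂ ∧ of r - of r₁ - of r₂ ∈ domainAddRel ∧ c = of r - of r₁ - of r₂}

/-- **Volume-preserving maps** between volume representations: the instances `[σ] − [Φ σ]` of KZ's
rule (2) both of whose terms are volume representations (so that the Jacobian clause of the move
reads `|det Φ'| = 1` on `σ`: `Φ` is a volume-preserving `ℚ`-semialgebraic injection, differentiable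
within `σ`).  The dimensions are equated propositionally (`n = m`) so that block flips
`σ × τ ↔ τ × σ` and other coordinate reindexings are literally generators.
[Kontsevich–Zagier 2001, §1.2 rule (2); Cresson–Viu-Sos 2022, §3 (volume-preserving relations)] -/
def soloInformedMapGen : Set FormalRep :=
  {c | ∃ (n m : ℕ) (r : IntegralRep n) (r' : IntegralRep m), n = m ∧ SoloInformedIsVolRep r ∧
    SoloInformedIsVolRep r' ∧ of r - of r' ∈ changeOfVariablesRel ∧ c = of r - of r'}

/-- **The scissors group of relations** `𝒮`: the subgroup of `FormalRep` generated by the scissors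
moves and the volume-preserving maps between volume representations.  The quotient of the free
abelian group on volume representations by `𝒮` is the Grothendieck group `K(ℚ)` of finite-volume
`ℚ`-semialgebraic sets modulo cut-and-paste and volume-preserving `ℚ`-semialgebraic injections.
[Cresson–Viu-Sos 2022, §3; this work, COROLLARY NF.2] -/
def soloInformedScissorsRel : AddSubgroup FormalRep :=
  AddSubgroup.closure (soloInformedScissorsGen ∪ soloInformedMapGen)

/-- Scissors moves are rule-(1a) moves. -/
theorem soloInformed_scissorsGen_subset_domainAddRel : soloInformedScissorsGen ⊆ domainAddRel := by
  rintro c ⟨n, r, r₁, r₂, -, -, -, h, rfl⟩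
  exact h

/-- Volume-preserving maps are rule-(2) moves. -/
theorem soloInformed_mapGen_subset_changeOfVariablesRel :
    soloInformedMapGen ⊆ changeOfVariablesRel := by
  rintro c ⟨n, m, r, r', -, -, -, h, rfl⟩
  exact h

/-- Scissors moves lie in `𝒮`. -/
theorem soloInformed_scissorsGen_subset_scissorsRel :
    soloInformedScissorsGen ⊆ soloInformedScissorsRel :=
  fun _ hc => AddSubgroup.subset_closure (Or.inl hc)

/-- Volume-preserving maps lie in `𝒮`. -/
theorem soloInformed_mapGen_subset_scissorsRel : soloInformedMapGen ⊆ soloInformedScissorsRel :=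
  fun _ hc => AddSubgroup.subset_closure (Or.inr hc)

/-- **`𝒮 ≤ relations₁₂`**: scissors congruence is equidimensional KZ-equivalence. [this work] -/
theorem soloInformed_scissorsRel_le_equidimRelations :
    soloInformedScissorsRel ≤ soloInformedEquidimRelations := by
  refine (AddSubgroup.closure_le _).mpr ?_
  rintro c (hc | hc)
  · exact soloInformed_domainAddRel_subset_equidimRelations
      (soloInformed_scissorsGen_subset_domainAddRel hc)
  · exact soloInformed_changeOfVariablesRel_subset_equidimRelations
      (soloInformed_mapGen_subset_changeOfVariablesRel hc)

/-- `𝒮 ≤ relations`. [this work] -/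
theorem soloInformed_scissorsRel_le_relations : soloInformedScissorsRel ≤ relations :=
  le_trans soloInformed_scissorsRel_le_equidimRelations soloInformed_equidimRelations_le_relations

/-- Scissors-congruent formal combinations have the same value: `eval = 0` on `𝒮`. [folklore] -/
theorem soloInformed_eval_eq_zero_of_mem_scissorsRel {c : FormalRep}
    (hc : c ∈ soloInformedScissorsRel) : eval c = 0 :=
  eval_eq_zero_of_mem_relations (soloInformed_scissorsRel_le_relations hc)

/-- **Constructor for scissors moves** from the set-level data `σ = σ₁ ∪ σ₂`, `vol (σ₁ ∩ σ₂) = 0`.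
[Kontsevich–Zagier 2001, §1.2 rule (1)] -/
theorem soloInformed_mem_scissorsGen {r r₁ r₂ : IntegralRep n} (hr : SoloInformedIsVolRep r)
    (h₁ : SoloInformedIsVolRep r₁) (h₂ : SoloInformedIsVolRep r₂)
    (hdom : r.domain = r₁.domain ∪ r₂.domain) (hnull : volume (r₁.domain ∩ r₂.domain) = 0) :
    of r - of r₁ - of r₂ ∈ soloInformedScissorsGen := by
  have e₁ : EqOn r.integrand r₁.integrand r₁.domain := fun x hx => by
    rw [h₁ x hx, hr x (by rw [hdom]; exact Or.inl hx)]
  have e₂ : EqOn r.integrand r₂.integrand r₂.domain := fun x hx => by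
    rw [h₂ x hx, hr x (by rw [hdom]; exact Or.inr hx)]
  exact ⟨n, r, r₁, r₂, hr, h₁, h₂, ⟨n, r, r₁, r₂, hdom, hnull, e₁, e₂, rfl⟩, rfl⟩

/-- **Constructor for volume-preserving maps** from rule-(2) data with `|det Φ'| = 1` on `σ`.
[Kontsevich–Zagier 2001, §1.2 rule (2)] -/
theorem soloInformed_mem_mapGen {r r' : IntegralRep n} (hr : SoloInformedIsVolRep r)
    (hr' : SoloInformedIsVolRep r') (Φ : (Fin n → ℝ) → (Fin n → ℝ))
    (Φ' : (Fin n → ℝ) → (Fin n → ℝ) →L[ℝ] (Fin n → ℝ)) (hΦ : IsSemialgebraicMapOn ℚ r.domain Φ)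
    (hΦ' : ∀ x ∈ r.domain, HasFDerivWithinAt Φ (Φ' x) r.domain x) (hinj : InjOn Φ r.domain)
    (hdom : r'.domain = Φ '' r.domain) (hdet : ∀ x ∈ r.domain, |(Φ' x).det| = 1) :
    of r - of r' ∈ soloInformedMapGen := by
  have hf : ∀ x ∈ r.domain, r.integrand x = r'.integrand (Φ x) * |(Φ' x).det| := fun x hx => by
    have hΦx : Φ x ∈ r'.domain := by rw [hdom]; exact mem_image_of_mem Φ hx
    rw [hr x hx, hdet x hx, mul_one, hr' _ hΦx]
  exact ⟨n, n, r, r', rfl, hr, hr', ⟨n, r, r', Φ, Φ', hΦ, hΦ', hinj, hdom, hf, rfl⟩, rfl⟩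

/-! ### First identities in `K(ℚ)` -/

/-- **Null sets vanish in `K(ℚ)`**: a volume representation with Lebesgue-null domain lies in `𝒮`
(`[N] = [N ∪ N] = [N] + [N]`). [Kontsevich–Zagier 2001, §1.2 rule (1)] -/
theorem soloInformed_of_mem_scissorsRel_of_volume_eq_zero {r : IntegralRep n}
    (hr : SoloInformedIsVolRep r) (h0 : volume r.domain = 0) : of r ∈ soloInformedScissorsRel := by
  have h : of r - of r - of r ∈ soloInformedScissorsGen :=
    soloInformed_mem_scissorsGen hr hr hr (union_self _).symm (by rwa [inter_self])
  have h' := soloInformedScissorsRel.neg_mem (soloInformed_scissorsGen_subset_scissorsRel h)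
  rwa [sub_self, zero_sub, neg_neg] at h'

/-- The empty volume representation vanishes in `K(ℚ)`. -/
theorem soloInformed_of_mem_scissorsRel_of_domain_eq_empty {r : IntegralRep n}
    (hr : SoloInformedIsVolRep r) (h : r.domain = ∅) : of r ∈ soloInformedScissorsRel :=
  soloInformed_of_mem_scissorsRel_of_volume_eq_zero hr (by rw [h, measure_empty])

/-- **Two volume representations with the same domain agree in `K(ℚ)`** (the identity map is a
volume-preserving map; the integrands may differ off the domain). [folklore] -/
theorem soloInformed_of_sub_of_mem_mapGen_of_domain_eq {r r' : IntegralRep n}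
    (hr : SoloInformedIsVolRep r) (hr' : SoloInformedIsVolRep r') (h : r.domain = r'.domain) :
    of r - of r' ∈ soloInformedMapGen := by
  refine soloInformed_mem_mapGen hr hr' (fun x => x) (fun _ => ContinuousLinearMap.id ℝ _)
    ?_ ?_ (fun x _ y _ hxy => hxy) ?_ ?_
  · exact (isSemialgebraicMapOn_aeval r.isSemialgebraic_domain
      (fun j => (MvPolynomial.X j : MvPolynomial (Fin n) ℚ))).congr fun x _ => by ext j; simp
  · exact fun x _ => (hasFDerivAt_id x).hasFDerivWithinAt
  · rw [image_id', h]
  · intro x _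
    rw [ContinuousLinearMap.det, ContinuousLinearMap.coe_id, LinearMap.det_id, abs_one]

/-- Two volume representations with the same domain are scissors congruent. -/
theorem soloInformed_of_sub_of_mem_scissorsRel_of_domain_eq {r r' : IntegralRep n}
    (hr : SoloInformedIsVolRep r) (hr' : SoloInformedIsVolRep r') (h : r.domain = r'.domain) :
    of r - of r' ∈ soloInformedScissorsRel :=
  soloInformed_mapGen_subset_scissorsRel (soloInformed_of_sub_of_mem_mapGen_of_domain_eq hr hr' h)

/-- **Rational translates agree in `K(ℚ)`**: the translate `σ + v` (`v ∈ ℚⁿ`) of a volume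
representation is a volume representation congruent to it by one volume-preserving map.
[Kontsevich–Zagier 2001, §1.2 rule (2); Viu-Sos 2021, Lemma 4.3] -/
theorem soloInformed_exists_translate {r : IntegralRep n} (hr : SoloInformedIsVolRep r)
    (v : Fin n → ℚ) :
    ∃ r' : IntegralRep n, r'.domain = (fun x => x - fun i => (v i : ℝ)) ⁻¹' r.domain ∧
      SoloInformedIsVolRep r' ∧ of r - of r' ∈ soloInformedMapGen := by
  obtain ⟨r', hd, hi, hrel⟩ := exists_translate r v
  have hr' : SoloInformedIsVolRep r' := fun x hx => by
    rw [hd] at hx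
    rw [hi]
    exact hr _ hx
  exact ⟨r', hd, hr', n, n, r, r', rfl, hr, hr', hrel, rfl⟩

/-! ### H3ₙ and STABLE-H3 -/

/-- **H3ₙ — the generalized Hilbert third problem of the KZ calculus in dimension `n`**: two volume
representations of dimension `n` with the same volume are congruent modulo scissors moves and
volume-preserving `ℚ`-semialgebraic maps.  (For `n ≤ 1` this holds; from `n = 2` on it is open —
e.g. whether the disc of radius `√2` is congruent to two unit discs — and no implication with the
period conjecture is claimed for a single `n`.)
[Cresson–Viu-Sos 2022, §1 ("generalized Hilbert third problem"), §5; this work, REMARK NF.5] -/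
def SoloInformedH3At (n : ℕ) : Prop :=
  ∀ (r r' : IntegralRep n), SoloInformedIsVolRep r → SoloInformedIsVolRep r' →
    r.value = r'.value → of r - of r' ∈ soloInformedScissorsRel

/-- **STABLE-H3 — the stable generalized Hilbert third problem of the KZ calculus**: two volume
representations of the same dimension with the same volume become congruent modulo scissors moves
and volume-preserving `ℚ`-semialgebraic maps after multiplying both by a cube `[0,1]ᵏ`.
COROLLARY NF.2 of this work asserts `KontsevichZagierPeriods ↔ SoloInformedStableH3`; this file
proves `←`. [Cresson–Viu-Sos 2022, §1, §5; this work, COROLLARY NF.2] -/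
def SoloInformedStableH3 : Prop :=
  ∀ (n : ℕ) (r r' : IntegralRep n), SoloInformedIsVolRep r → SoloInformedIsVolRep r' →
    r.value = r'.value →
      ∃ k, of (soloInformedFlatIter r k) - of (soloInformedFlatIter r' k) ∈ soloInformedScissorsRel

/-- H3 in every dimension implies STABLE-H3 (`k = 0`). [folklore] -/
theorem soloInformed_stableH3_of_forall_h3At (h : ∀ n, SoloInformedH3At n) : SoloInformedStableH3 :=
  fun n r r' hr hr' hv => ⟨0, h n r r' hr hr' hv⟩

/-- **STABLE-H3 implies the volume form of Conjecture 1** (`KZ.volumeConjectureCompact` of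
Cresson–Viu-Sos): stably scissors-congruent compact volumes are KZ-equivalent, since `𝒮 ≤ relations`
and `[r × [0,1]ᵏ] ∼ [r]`. [Cresson–Viu-Sos 2022, §1 p. 326, Thm. 2.1; this work, COROLLARY NF.2] -/
theorem soloInformed_volumeConjectureCompact_of_stableH3 (h : SoloInformedStableH3) :
    volumeConjectureCompact := by
  intro d r r' _ _ _ _ h1 h1' hv
  obtain ⟨k, hk⟩ := h d r r' h1 h1' hv
  exact soloInformed_equivalent_of_flatIter_sub_mem r r' k
    (soloInformed_scissorsRel_le_equidimRelations hk)

/-- **STABLE-H3 implies the Kontsevich–Zagier period conjecture** (the direction `←` of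
COROLLARY NF.2; the `K(ℚ)`-analogue of "GKZ ⟹ KZ" [Cresson–Viu-Sos 2022, Thm. 2.1]), via the volume
form of Conjecture 1 and Viu-Sos' semi-canonical reduction.
[Cresson–Viu-Sos 2022, §1 p. 326, Thm. 2.1; Viu-Sos 2021, Thm. 1.1; this work, COROLLARY NF.2] -/
theorem soloInformed_summit_of_stableH3 (h : SoloInformedStableH3) : KontsevichZagierPeriods := by
  have h₁ : KZPeriodConjecture' ↔ volumeConjectureCompact :=
    kzPeriodConjecture'_iff_volumeConjectureCompact_holds
  rw [KontsevichZagierPeriods_iff, ← kzPeriodConjecture'_iff_isRational, h₁]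
  exact soloInformed_volumeConjectureCompact_of_stableH3 h

/-- **H3 in every dimension implies the Kontsevich–Zagier period conjecture.**
[Cresson–Viu-Sos 2022, Thm. 2.1; this work, REMARK NF.5] -/
theorem soloInformed_summit_of_forall_h3At (h : ∀ n, SoloInformedH3At n) : KontsevichZagierPeriods :=
  soloInformed_summit_of_stableH3 (soloInformed_stableH3_of_forall_h3At h)

end Summit.KontsevichZagierPeriods.KontsevichZagierPeriods.Theorems

end
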